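import Literature.Topology.FourManifolds.GaussDiagrams
import HarnessLib

/-!
# Reidemeister moves on Gauss diagrams: the anti-parallel second move, and Reidemeister's
# theorem restated for a generating set of oriented moves

This file supplements `Literature.Topology.FourManifolds.GaussDiagrams`. It does not change
any declaration there; it records a discrepancy between the move set `GaussDiagram.PolyakMove`
and the sources originally cited for the statement `Knot.reidemeister`, defines the enlarged
move set `GaussDiagram.RMove` / `GaussDiagram.REquiv`, and records for it (last section,
documentation only) the corrected form of `Knot.reidemeister` — Reidemeister's theorem in
Gauss-diagram form for a *generating* set of oriented moves — to be vendored as the named fact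
`Knot.isIsotopic_iff_rEquiv`. (Verdict clean-up 2026-08-17: `Knot.reidemeister` is kept in
`GaussDiagrams`, name and body unchanged, as a registered open statement, because seventeen
files take it as a hypothesis; see its docstring.)

## The discrepancy

`GaussDiagram.PolyakMove` has the constructors `omega1a`, `omega1b` (all four oriented first
moves `Ω1a–Ω1d`), `omega2a` (the two *co-oriented* = braid-like second moves: new arrows `x, y`
with `overPos y = overPos x + 1` and `underPos y = underPos x + 1`, signs `ε, -ε`; Polyak's
`Ω2a, Ω2b`) and `omega3a`, which requires all three crossings positive and the braid pattern
`σ₁σ₂σ₁ → σ₂σ₁σ₂`. In Polyak's notation the third move with all three crossings positive is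
`Ω3b` ("This is the only `Ω3` move with all three positive crossings", Polyak (2010), footnote
to §1, p. 2), whereas the generator `Ω3a` of Polyak's minimal generating set
`{Ω1a, Ω1b, Ω2a, Ω3a}` (Polyak (2010), Thm. 1.1) is the *cyclic* third move. Hence the
constructors of `PolyakMove` are `S* = {Ω1a, Ω1b, Ω1c, Ω1d, Ω2a, Ω2b, Ω3b}`: all first moves
and the *braid-like* second and third moves (the remaining braid-like third moves follow from
`Ω3b` and `Ω2a, Ω2b`, Audoux–Fiedler (2005), Lemma 1.3; Ito–Iwamoto (2025), Remark 4.6). This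
set does **not** contain Polyak's generating set: by Polyak (2010), Thm. 1.2, a set of at most
five moves whose only third move is `Ω3b` generates iff it contains the *anti-parallel* second
moves `Ω2c` **and** `Ω2d` (and a compatible pair of first moves), and by Polyak (2010),
Lemma 3.8 (cf. §1, p. 4: "(by Markov theorem) the set `Ω1a, Ω1c, Ω2a, Ω2b` and `Ω3b` … is not
sufficient to connect any pair of general diagrams representing the same link") no *two* first
moves make `{Ω2a, Ω2b, Ω3b}` generating. Polyak's obstruction (numbers `C⁺, C⁻` of Seifert circles and the
writhe) does not survive all four first moves, and whether `S*` generates all oriented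
Reidemeister moves is precisely the open question of Audoux–Fiedler (2005), §1 ("Is the natural
analogue of Markov's theorem still true, i.e. do braid-like isotopies and Markov moves (i.e. the
four types of Reidemeister I moves in the plane) generate isotopies of oriented links in
3-space?"); it is not settled by Abel (2017), §4.3 (braid-like isotopy *without* first moves is
strictly finer than isotopy: an unknot diagram with the HOMFLY-PT homology of a trefoil) nor by
Ito–Iwamoto (2025), whose non-generation results for `{Ω2a, Ω2b, Ω3b}` (Prop. 4.18, Thm. 3.6)
assume exactly two first moves. Consequently the direction "isotopic ⇒ equivalent diagrams" of
`Knot.reidemeister` is not covered by any published theorem (an exhaustive search reported in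
the notes of the proving seat finds a 5-crossing diagram of the unknot that is not
`GaussDiagram.Equiv`-trivial through diagrams with at most 8 arrows — evidence, not a proof,
that it may even fail).

## The correction

`GaussDiagram.RMove` adds to `PolyakMove` the anti-parallel second move `omega2c` (new arrows
`x, y` with `overPos y = overPos x + 1` and `underPos x = underPos y + 1`, signs `ε, -ε`; as
`ε = ±1` these are Polyak's `Ω2c` and `Ω2d`), and `GaussDiagram.REquiv` is the equivalence
relation it generates. The move set of `RMove` contains `{Ω1a, Ω1b, Ω2c, Ω2d, Ω3b}`, which is a
generating set of oriented Reidemeister moves (Polyak (2010), Thm. 1.2, "if" part, proved in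
§3: `Ω3a` from `Ω2c, Ω2d, Ω3b`, then Lemmas 2.2–2.6), so `REquiv` is Reidemeister equivalence of
(possibly virtual) Gauss diagrams; with `REquiv` in place of `Equiv`, the statement of
`Knot.reidemeister` becomes Reidemeister's theorem (1927) combined with Polyak (2010), Thm. 1.2
and Goussarov–Polyak–Viro (2000), Thm. 1.B, exactly as intended by its original docstring.
That statement is recorded, as documentation only, in the last section of this file.

## Sources

* K. Reidemeister, *Elementare Begründung der Knotentheorie*, Abh. Math. Sem. Univ. Hamburg 5
  (1927) 24–32.
* M. Polyak, *Minimal generating sets of Reidemeister moves*, Quantum Topol. 1 (2010) 399–411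
  (arXiv:0908.3127): Thm. 1.1, Thm. 1.2, footnote p. 2, §1 p. 4, Lemma 3.8, §3.
* B. Audoux, T. Fiedler, *A Jones polynomial for braid-like isotopies of oriented links and its
  categorification*, Algebr. Geom. Topol. 5 (2005) 1535–1553 (arXiv:math/0503080): Def. 1.1,
  Lemma 1.3, Question in §1.
* M. Goussarov, M. Polyak, O. Viro, *Finite-type invariants of classical and virtual knots*,
  Topology 39 (2000) 1045–1068, §1.5, Thm. 1.B ("virtually isotopic classical knots are
  isotopic"; Thm. 1.2 of arXiv:math/9810073).
* M. Abel, *HOMFLY-PT homology for general link diagrams and braidlike isotopy*, Algebr. Geom.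
  Topol. 17 (2017) 3021–3056 (arXiv:1607.00314), Ex. 4.5, §4.3 (status only).
* N. Ito, Y. Iwamoto, *Minimal generating sets of Reidemeister moves*, arXiv:2511.19918 (2025),
  Thm. 3.6, Prop. 4.18, Remark 4.6 (status only).
-/

open scoped Manifold ContDiff Topology
open Function Set

noncomputable section

namespace Literature.Topology.FourManifolds

namespace GaussDiagram

/-- **Reidemeister moves on Gauss diagrams, generating version**: the Polyak moves
`GaussDiagram.PolyakMove` (all four oriented first moves, the two co-oriented second moves
`Ω2a, Ω2b`, the positive braid-like third move `Ω3b` in the notation of Polyak (2010), and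
relabelling) together with the **anti-parallel second move** `omega2c`: two new arrows
`x = Fin.last n` (sign `ε`) and `y = Fin.last (n + 1)` (sign `-ε`) whose tails are adjacent with
`overPos y = overPos x + 1` and whose heads are adjacent in the *opposite* order,
`underPos x = underPos y + 1` (the over-strand and the under-strand of the new bigon point in
opposite directions; `ε = 1` and `ε = -1` are Polyak's `Ω2c` and `Ω2d`). The resulting set of
moves contains the generating set `{Ω1a, Ω1b, Ω2c, Ω2d, Ω3b}` of oriented Reidemeister moves.
Polyak (2010), Thm. 1.2 and Fig. 2; GPV (2000), §1.5, Fig. 3. [cite: Polyak2010, Thm 1.2] -/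
inductive RMove : GaussDiagram → GaussDiagram → Prop
  /-- A Polyak move (`relabel`, `Ω1a–d`, `Ω2a/b`, `Ω3b`). -/
  | polyak {G G' : GaussDiagram} (h : PolyakMove G G') : RMove G G'
  /-- `Ω2c/Ω2d` (anti-parallel second move): two new arrows `x = Fin.last n` (inserted first,
  sign `ε`) and `y = Fin.last (n + 1)` (sign `-ε`) with `overPos y = overPos x + 1` and
  `underPos x = underPos y + 1`. Polyak (2010), Fig. 2, `Ω2c, Ω2d`. -/
  | omega2c (G : GaussDiagram) (o : Fin (2 * G.n + 2)) (u : Fin (2 * G.n + 1))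
      (o' : Fin (2 * (G.n + 1) + 2)) (u' : Fin (2 * (G.n + 1) + 1)) (ε : ℤˣ)
      (hover : (((G.insertChord o u ε).insertChord o' u' (-ε)).overPos (Fin.last (G.n + 1)) : ℕ)
        = ((G.insertChord o u ε).insertChord o' u' (-ε)).overPos (Fin.last G.n).castSucc + 1)
      (hunder : (((G.insertChord o u ε).insertChord o' u' (-ε)).underPos (Fin.last G.n).castSucc
          : ℕ)
        = ((G.insertChord o u ε).insertChord o' u' (-ε)).underPos (Fin.last (G.n + 1)) + 1) :
      RMove G ((G.insertChord o u ε).insertChord o' u' (-ε))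

/-- **Reidemeister equivalence** of Gauss diagrams for the generating move set `RMove`
(`Relation.EqvGen`; the symmetric closure supplies the inverse moves). Since the moves of
`RMove` contain the generating set `{Ω1a, Ω1b, Ω2c, Ω2d, Ω3b}` (Polyak (2010), Thm. 1.2), this is
the equivalence relation generated by all oriented Reidemeister moves on Gauss diagrams,
applied regardless of planarity (GPV (2000), §1.5). [cite: Polyak2010, Thm 1.2] -/
protected def REquiv : GaussDiagram → GaussDiagram → Prop :=
  Relation.EqvGen RMove

/-- `REquiv` is an equivalence relation. [folklore] -/
theorem equivalence_rEquiv : Equivalence GaussDiagram.REquiv :=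
  Relation.EqvGen.is_equivalence _

/-- `REquiv` is reflexive. [folklore] -/
protected theorem REquiv.refl (G : GaussDiagram) : G.REquiv G :=
  Relation.EqvGen.refl G

/-- `REquiv` is symmetric. [folklore] -/
protected theorem REquiv.symm {G G' : GaussDiagram} (h : G.REquiv G') : G'.REquiv G :=
  Relation.EqvGen.symm _ _ h

/-- `REquiv` is transitive. [folklore] -/
protected theorem REquiv.trans {G G' G'' : GaussDiagram} (h : G.REquiv G') (h' : G'.REquiv G'') :
    G.REquiv G'' :=
  Relation.EqvGen.trans _ _ _ h h'

/-- A move of `RMove` is an `REquiv`-equivalence. [folklore] -/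
theorem RMove.rEquiv {G G' : GaussDiagram} (h : RMove G G') : G.REquiv G' :=
  Relation.EqvGen.rel _ _ h

/-- A Polyak move is an `REquiv`-equivalence. [folklore] -/
theorem PolyakMove.rEquiv {G G' : GaussDiagram} (h : PolyakMove G G') : G.REquiv G' :=
  (RMove.polyak h).rEquiv

/-- Polyak equivalence (`GaussDiagram.Equiv`, generated by the braid-like moves and all first
moves) implies Reidemeister equivalence `REquiv`. (The converse is the open question of
Audoux–Fiedler (2005), §1.) [cite: AudouxFiedler2005, §1] -/
theorem Equiv.rEquiv {G G' : GaussDiagram} (h : G.Equiv G') : G.REquiv G' :=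
  Relation.EqvGen.mono (fun _ _ hm ↦ RMove.polyak hm) G G' h

end GaussDiagram

/-!
## The corrected statement: Reidemeister's theorem for `REquiv` (documentation; to be vendored)

With `REquiv` in place of `Equiv`, the statement of `Knot.reidemeister` is a faithful rendering
of published theorems. It is to be vendored here, by a fact-vending seat, as

```
/-- Reidemeister's theorem, Gauss-diagram form … [cite: Polyak2010, Thm. 1.2 (with
Reidemeister 1927 and GPV 2000 Thm. 1.B)] -/
def Knot.isIsotopic_iff_rEquiv : Prop :=
  ∀ {K K' : Knot} {G G' : GaussDiagram}, K.HasGaussDiagram G → K'.HasGaussDiagram G' →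
    (K.IsIsotopic K' ↔ G.REquiv G')
```

`→`: Reidemeister (1927): diagrams of isotopic links in `ℝ³ = 𝕊³ ∖ {northPole}` (an ambient
isotopy of a circle can be pushed off a point) are related by plane isotopy and oriented
Reidemeister moves; Polyak (2010), Thm. 1.2 ("if" part, §3): every oriented Reidemeister move
is a composite, inside its changing disc, of `Ω1a, Ω1b, Ω2c, Ω2d, Ω3b` and their inverses; each
of these is a constructor of `RMove` (`PolyakMove.omega1a/omega1b` with `ε = 1`, `RMove.omega2c`
with `ε = ±1`, `PolyakMove.omega3a`, which is Polyak's `Ω3b`) up to the bookkeeping move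
`PolyakMove.relabel`, and plane isotopy does not change the Gauss diagram up to `relabel`.
`←`: every constructor of `RMove` is a Reidemeister move of Gauss diagrams in the sense of GPV
(2000), §1 (virtual isotopy), and virtually isotopic classical knots are isotopic (GPV (2000),
§1.5, Thm. 1.B, via the peripheral system). Its immediate consequences (each a one-line proof
from the fact `h`): Polyak-equivalent Gauss diagrams of knots present isotopic knots
(`(h hG hG').2 he.rEquiv`, the valid direction of the open statement `Knot.reidemeister`);
knots with a common Gauss diagram are isotopic; a knot with Gauss diagram `G` is unknotted iff
`G.REquiv GaussDiagram.empty` (with `unknot_hasGaussDiagram_empty`).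

The fact is not declared in this revision: both seats that have handled the discrepancy so
far (the proving seat of `Knot.reidemeister`, 2026-08, and the verdict clean-up seat,
2026-08-17) are forbidden by D-0026 from adding an unproved named fact (`lint.fact-fanout`).
For the original `Knot.reidemeister` (move set `PolyakMove`) the direction `→` is the open
question of Audoux–Fiedler (2005), §1; that declaration is kept in `GaussDiagrams`, name and
body unchanged, as a registered open statement (`OPEN CONJECTURE — … [status: open]`).
-/

end Literature.Topology.FourManifolds
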